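import Literature.NumberTheory.PAdicHodge.BmaxPlusRemainder
import Literature.NumberTheory.PAdicHodge.BmaxPlusTUnitTwo
import HarnessLib

/-!
# Colmez's `t`-divisibility criterion, Frobenius form: `θ(φᵏ x) = 0` for all `k` implies `p·φ(x) ∈ t·A_max`

Topic `Literature/NumberTheory/PAdicHodge`; namespace `Literature.NumberTheory.PAdicHodge`. THEOREMS ONLY (no definition, no named
fact, no instance). Reproduction of [Colmez1998Annals, Lemme III.3.4] (with the ingredients [Lemme III.3.8] and [Lemme III.3.9]) on
Colmez's `A_max = B_max⁺(F)` = `BmaxPlus F p` (the `p`-adic completion of `B⁰_max = 𝔸_inf[ξ/p]`); notation: `ι = ainfToBmaxPlus`,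
`φ = frobBmaxPlus`, `θ = thetaBmaxPlus`, `t = tBmax = log[ε]`, `u = [ε] − 1 = uAinf`, `ξ/p = omegaB`,
`ω = 1 + [ε^{1/p}] + ⋯ + [ε^{1/p}]^{p−1} = omega`.

* `frobenius_omega`, `uAinf_dvd_frobenius_omega_sub_natCast` — **`φ(ω) = 1 + [ε] + ⋯ + [ε]^{p−1} ≡ p (mod [ε] − 1)`** in `𝔸_inf`
  (proof of [Colmez1998Annals, Lemme III.3.8]);
* `exists_eq_ainf_add_sub_mul_of_representatives` — the division-with-remainder engine of `BmaxPlusRemainder.exists_eq_ainf_add_sub_mul`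
  for an ARBITRARY generator `ω₁ ∈ B⁰_max`, from compatible polynomial representatives `g ≡ Q_n(ω₁) (mod pⁿ)`;
* ★ `exists_frobBmaxPlus_eq_ainf_add_sub_mul` — **`φ(g) = ι(a) + (φ(ξ/p) − ι d)·G`** for every `g ∈ A_max` and
  `d ∈ 𝔸_inf` (the representatives `Q_n` of `g` in `ξ/p` give representatives `φQ_n` of `φ(g)` in `φ(ξ/p)`);
* `natCast_mul_frobBmaxPlus_omegaB_mul_sub_one` — **`p·(φ(ξ/p)·ι(φc) − 1) = ι(u)·ι(s)`** where `ω = ξ·c` and `φ(ω) = p + u·s`, i.e.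
  `φ(ω/p) ≡ 1 (mod (u/p)·A_max)` [Colmez1998Annals, Lemme III.3.8];
* ★★ `exists_natCast_mul_frobBmaxPlus_eq_ainf_add_uAinf_mul` — **`p·φ(g) ∈ ι(𝔸_inf) + ι(u)·A_max` for every `g ∈ A_max`**
  ([Colmez1998Annals, Lemme III.3.8]: `φ(x) − φ(Σ[a_n]) ∈ (u/p)·A_max`; here `c = ω/ξ ∈ 𝔸_infˣ` by `isUnit_of_omega_eq_xi_mul`);
* ★★★ `exists_natCast_mul_frobBmaxPlus_eq_tBmax_mul` — **[Colmez1998Annals, Lemme III.3.4]: if `θ(φᵏ x) = 0` for every `k ≥ 0`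
  then `p·φ(x) = t·y` for some `y ∈ A_max`** (apply `θ ∘ φᵏ` to `p·φ(x) = ι(a) + ι(u)·G`: `θ(φᵏ u) = 0`, so `θ(φᵏ a) = 0` for all
  `k` and `a ∈ u·𝔸_inf` by Fontaine's `𝔸_inf`-lemma `uAinf_dvd_iff_forall_fontaineTheta_frobenius_iterate_eq_zero`
  [Colmez1998Annals, Lemme III.3.7]; finally `u ∈ t·A_maxˣ` [Colmez1998Annals, Lemme III.3.9] = tree `exists_isUnit_tBmax_eq_uAinf_mul'`),
  and the saturated form `exists_pow_mul_frobBmaxPlus_eq_tBmax_mul`.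

Only `φ(x)` (not `x`) is divisible: Colmez proves exactly this ([Colmez1998Annals, Remarque III.3.5]); the statement for `x` itself
needs the larger rings `B_max⁺ ⊂ φ^{-1}(B_max⁺)`. No surjectivity hypothesis on Fontaine's `θ` is needed. Consumer: the Langlands
seat's `B_max(F)^{Γ_F} = F₀` for EVERY `p`-adic field `F` (binder `(TC)` of `Summits/Langlands/Langlands/Theorems/SoloInformedBmaxInvariantsTCriterion`).

## References
* [Colmez1998Annals] P. Colmez, *Théorie d'Iwasawa des représentations de de Rham d'un corps local*, Ann. of Math. 148 (1998),
  485–571, §III.2 (Lemme III.2.2) and §III.3 (Lemmes III.3.4, III.3.7, III.3.8, III.3.9; author's version pp. 25–29).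
* [FontaineAsterisque223III] J.-M. Fontaine, *Le corps des périodes p-adiques*, Astérisque 223 (1994), Exp. III Prop. 5.1.3.
-/

noncomputable section

open WittVector Field ValuativeRel Polynomial Finset
open Literature.AlgebraicGeometry.Resolution

namespace Literature.NumberTheory.PAdicHodge

open Literature.NumberTheory.GaloisRepresentations
open Literature.NumberTheory.GaloisRepresentations.IsNonarchimedeanLocalField

variable {F : Type} [Field F] [ValuativeRel F] [TopologicalSpace F] [IsNonarchimedeanLocalField F]
  [CharZero F] {p : ℕ} [Fact p.Prime] [Fact (¬ IsUnit (p : integerC F))]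
  [IsAdicComplete (Ideal.span {(p : integerC F)}) (integerC F)]

/-! ### `φ(ω) ≡ p (mod [ε] − 1)` in `𝔸_inf` -/

omit [IsAdicComplete (Ideal.span {(p : integerC F)}) (integerC F)] in
/-- **`φ(ω) = 1 + [ε] + ⋯ + [ε]^{p−1}`** (`φ[ε^{1/p}] = [ε^{1/p}]^p = [ε]`). [cite: Colmez1998Annals, Lemme III.3.8] -/
theorem frobenius_omega :
    (WittVector.frobenius : Ainf (p := p) F →+* Ainf (p := p) F) omega =
      ∑ i ∈ range p, teichmuller p (eps : PreTilt (integerC F) p) ^ i := by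
  rw [omega_def, map_sum]
  refine sum_congr rfl fun i _ => ?_
  rw [map_pow, frobenius_teichmuller, ← map_pow, epsRoot_pow]

omit [IsAdicComplete (Ideal.span {(p : integerC F)}) (integerC F)] in
/-- **`φ(ω) − p ∈ ([ε] − 1)·𝔸_inf`**: `φ(ω) − p = Σ_{i<p} ([ε]^i − 1)`. [cite: Colmez1998Annals, Lemme III.3.8] -/
theorem uAinf_dvd_frobenius_omega_sub_natCast :
    (uAinf : Ainf (p := p) F) ∣
      (WittVector.frobenius : Ainf (p := p) F →+* Ainf (p := p) F) omega - (p : Ainf (p := p) F) := by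
  have h : (WittVector.frobenius : Ainf (p := p) F →+* Ainf (p := p) F) omega - (p : Ainf (p := p) F) =
      ∑ i ∈ range p, (teichmuller p (eps : PreTilt (integerC F) p) ^ i - 1) := by
    rw [sum_sub_distrib, frobenius_omega, sum_const, card_range, nsmul_eq_mul, mul_one]
  rw [h, uAinf_def]
  exact dvd_sum fun i _ => by
    simpa only [one_pow] using sub_dvd_pow_sub_pow (teichmuller p (eps : PreTilt (integerC F) p)) 1 i

/-! ### Division with remainder by `ω₁ − d` from compatible polynomial representatives -/

omit [CharZero F] [IsAdicComplete (Ideal.span {(p : integerC F)}) (integerC F)] in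
/-- Polynomial division by `X − d`: `Q = Q(d) + (X − d)·(Q /ₘ (X − d))`. [folklore] -/
private theorem eq_C_eval_add_X_sub_C_mul' (Q : (Ainf (p := p) F)[X]) (d : Ainf (p := p) F) :
    Q = C (Q.eval d) + (X - C d) * (Q /ₘ (X - C d)) := by
  have h := modByMonic_add_div Q (X - C d)
  rw [modByMonic_X_sub_C_eq_C_eval] at h
  exact h.symm

set_option maxHeartbeats 1600000 in
set_option synthInstance.maxHeartbeats 400000 in
omit [CharZero F] [IsAdicComplete (Ideal.span {(p : integerC F)}) (integerC F)] in
/-- **Division with remainder by `ω₁ − d`, from compatible polynomial representatives**: if `g ≡ Q_n(ω₁) (mod pⁿ B⁰_max)` for all `n`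
with `Q_{n+1} = Q_n + pⁿ·R_n` (`Q_n, R_n ∈ 𝔸_inf[X]`, `ω₁ ∈ B⁰_max` arbitrary), then for every `d ∈ 𝔸_inf` there are `a ∈ 𝔸_inf` and
`G ∈ A_max` with `g = ι(a) + (ω₁ − ι d)·G` (divide each `Q_n` by `X − d`; the constant terms converge `p`-adically in `𝔸_inf`, the
quotients evaluated at `ω₁` converge in `A_max`). The engine of `exists_eq_ainf_add_sub_mul` (the case `ω₁ = ξ/p`).
[cite: Colmez1998Annals, §III.2] -/
theorem exists_eq_ainf_add_sub_mul_of_representatives {g : BmaxPlus F p} {ω₁ : bmaxZero F p}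
    {Q R : ℕ → (Ainf (p := p) F)[X]}
    (hQ : ∀ n, AdicCompletion.evalₐ (Ideal.span {(p : bmaxZero F p)}) n g = Ideal.Quotient.mk _ (aeval ω₁ (Q n)))
    (hQR : ∀ n, Q (n + 1) = Q n + C ((p : Ainf (p := p) F) ^ n) * R n) (d : Ainf (p := p) F) :
    ∃ (a : Ainf (p := p) F) (G : BmaxPlus F p),
      g = ainfToBmaxPlus F p a + (algebraMap (bmaxZero F p) (BmaxPlus F p) ω₁ - ainfToBmaxPlus F p d) * G := by
  -- constant terms and quotients, written as telescoping sums so that compatibility is automatic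
  obtain ⟨a, ha0, ha_succ⟩ : ∃ a : ℕ → Ainf (p := p) F, a 0 = (Q 0).eval d ∧
      ∀ n, a (n + 1) = a n + (p : Ainf (p := p) F) ^ n * (R n).eval d :=
    ⟨fun n => (Q 0).eval d + ∑ i ∈ range n, (p : Ainf (p := p) F) ^ i * (R i).eval d,
      by simp only [sum_range_zero, add_zero], fun n => by simp only [sum_range_succ, add_assoc]⟩
  obtain ⟨S, hS0, hS_succ⟩ : ∃ S : ℕ → (Ainf (p := p) F)[X], S 0 = (Q 0) /ₘ (X - C d) ∧
      ∀ n, S (n + 1) = S n + C ((p : Ainf (p := p) F) ^ n) * ((R n) /ₘ (X - C d)) :=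
    ⟨fun n => (Q 0) /ₘ (X - C d) + ∑ i ∈ range n, C ((p : Ainf (p := p) F) ^ i) * ((R i) /ₘ (X - C d)),
      by simp only [sum_range_zero, add_zero], fun n => by simp only [sum_range_succ, add_assoc]⟩
  have hQaS : ∀ n, Q n = C (a n) + (X - C d) * S n := by
    intro n
    induction n with
    | zero => rw [ha0, hS0]; exact eq_C_eval_add_X_sub_C_mul' (Q 0) d
    | succ n ih =>
      rw [hQR n, ih, ha_succ, hS_succ, map_add, map_mul]
      have e := eq_C_eval_add_X_sub_C_mul' (R n) d
      linear_combination (C ((p : Ainf (p := p) F) ^ n)) * e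
  -- the constant terms converge `p`-adically in `𝔸_inf`
  have ha_cauchy : ∀ N, a (N + 1) - a N ∈ Ideal.span {((p : Ainf (p := p) F)) ^ N} := by
    intro N
    rw [ha_succ, add_sub_cancel_left, Ideal.mem_span_singleton]
    exact ⟨(R N).eval d, rfl⟩
  obtain ⟨L, hL⟩ := GaloisContinuity.exists_padic_lim_ainf ha_cauchy
  -- the quotients converge `p`-adically in `A_max`
  have hS_tel : ∀ {m n : ℕ}, m ≤ n → aeval ω₁ (S n) - aeval ω₁ (S m) ∈ Ideal.span {(p : bmaxZero F p)} ^ m := by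
    intro m n hmn
    induction n, hmn using Nat.le_induction with
    | base => rw [sub_self]; exact Submodule.zero_mem _
    | succ n hmn ih =>
      have e : aeval ω₁ (S (n + 1)) - aeval ω₁ (S m) =
          (p : bmaxZero F p) ^ n * aeval ω₁ ((R n) /ₘ (X - C d)) + (aeval ω₁ (S n) - aeval ω₁ (S m)) := by
        rw [hS_succ, map_add, map_mul, aeval_C, map_pow, map_natCast]; ring
      rw [e]
      refine add_mem ?_ ih
      rw [Ideal.span_singleton_pow]
      exact Ideal.mul_mem_right _ _
        (Ideal.span_singleton_le_span_singleton.2 (pow_dvd_pow _ hmn) (Ideal.mem_span_singleton_self _))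
  have hS_cauchy : AdicCompletion.IsAdicCauchy (Ideal.span {(p : bmaxZero F p)}) (bmaxZero F p)
      fun n => aeval ω₁ (S n) := by
    intro m n hmn
    rw [SModEq.sub_mem, smul_eq_mul, Ideal.mul_top, ← Ideal.neg_mem_iff, neg_sub]
    exact hS_tel hmn
  obtain ⟨G, hG⟩ : ∃ G : BmaxPlus F p, ∀ n, AdicCompletion.evalₐ (Ideal.span {(p : bmaxZero F p)}) n G =
      Ideal.Quotient.mk _ (aeval ω₁ (S n)) :=
    ⟨AdicCompletion.mk (Ideal.span {(p : bmaxZero F p)}) (bmaxZero F p) ⟨fun n => aeval ω₁ (S n), hS_cauchy⟩,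
      fun n => AdicCompletion.evalₐ_mk _ _ _⟩
  refine ⟨L, G, AdicCompletion.ext_evalₐ fun n => ?_⟩
  -- compare at level `n`
  have e2 : AdicCompletion.evalₐ (Ideal.span {(p : bmaxZero F p)}) n (algebraMap (bmaxZero F p) (BmaxPlus F p) ω₁) =
      Ideal.Quotient.mk _ ω₁ := AdicCompletion.evalₐ_of _ n _
  have e3 : AdicCompletion.evalₐ (Ideal.span {(p : bmaxZero F p)}) n
      (ainfToBmaxPlus F p L + (algebraMap (bmaxZero F p) (BmaxPlus F p) ω₁ - ainfToBmaxPlus F p d) * G) =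
      Ideal.Quotient.mk _ (algebraMap (Ainf (p := p) F) (bmaxZero F p) L +
        (ω₁ - algebraMap (Ainf (p := p) F) (bmaxZero F p) d) * aeval ω₁ (S n)) := by
    simp only [map_add, map_mul, map_sub, evalₐ_ainfToBmaxPlus, hG n, e2]
  rw [e3, hQ n, Ideal.Quotient.eq, hQaS n]
  have e4 : aeval ω₁ (C (a n) + (X - C d) * S n) -
      (algebraMap (Ainf (p := p) F) (bmaxZero F p) L +
        (ω₁ - algebraMap (Ainf (p := p) F) (bmaxZero F p) d) * aeval ω₁ (S n)) =
      - algebraMap (Ainf (p := p) F) (bmaxZero F p) (L - a n) := by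
    simp only [map_add, map_mul, map_sub, aeval_C, aeval_X]
    ring
  rw [e4, Ideal.neg_mem_iff]
  have h4 := hL n
  rw [Ideal.mem_span_singleton] at h4
  obtain ⟨c, hc⟩ := h4
  rw [hc, map_mul, map_pow, map_natCast, Ideal.span_singleton_pow]
  exact Ideal.mul_mem_right _ _ (Ideal.mem_span_singleton_self _)

/-! ### `φ(g) = ι(a) + (φ(ξ/p) − ι d)·G` -/

omit [CharZero F] [IsAdicComplete (Ideal.span {(p : integerC F)}) (integerC F)] in
/-- `φ` on `B⁰_max` commutes with evaluation of `𝔸_inf`-polynomials: `φ(Q(ω₁)) = (φQ)(φ ω₁)`. [folklore] -/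
private theorem frobBmaxZero_aeval (ω₁ : bmaxZero F p) (Q : (Ainf (p := p) F)[X]) :
    frobBmaxZero F p (aeval ω₁ Q) =
      aeval (frobBmaxZero F p ω₁) (Q.map (WittVector.frobenius : Ainf (p := p) F →+* Ainf (p := p) F)) := by
  refine Polynomial.map_aeval_eq_aeval_map (RingHom.ext fun x => ?_) Q ω₁
  rw [RingHom.comp_apply, RingHom.comp_apply, frobBmaxZero_algebraMap]

set_option maxHeartbeats 1600000 in
omit [CharZero F] [IsAdicComplete (Ideal.span {(p : integerC F)}) (integerC F)] in
/-- ★ **`φ(g) = ι(a) + (φ(ξ/p) − ι d)·G`** for every `g ∈ A_max` and `d ∈ 𝔸_inf`: the compatible representatives `Q_n` of `g`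
(`exists_polynomial_representatives`) give compatible representatives `φQ_n` of `φ(g)` in the generator `φ(ξ/p)` of `B⁰_max`.
[cite: Colmez1998Annals, Lemme III.3.8] -/
theorem exists_frobBmaxPlus_eq_ainf_add_sub_mul (g : BmaxPlus F p) (d : Ainf (p := p) F) :
    ∃ (a : Ainf (p := p) F) (G : BmaxPlus F p),
      frobBmaxPlus F p g = ainfToBmaxPlus F p a +
        (frobBmaxPlus F p (algebraMap (bmaxZero F p) (BmaxPlus F p) omegaB) - ainfToBmaxPlus F p d) * G := by
  obtain ⟨Q, R, hQ, hQR⟩ := exists_polynomial_representatives g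
  have hQ' : ∀ n, AdicCompletion.evalₐ (Ideal.span {(p : bmaxZero F p)}) n (frobBmaxPlus F p g) =
      Ideal.Quotient.mk _ (aeval (frobBmaxZero F p omegaB)
        ((Q n).map (WittVector.frobenius : Ainf (p := p) F →+* Ainf (p := p) F))) := fun n => by
    rw [evalₐ_frobBmaxPlus_of_eq n (hQ n), frobBmaxZero_aeval]
  have hQR' : ∀ n, (Q (n + 1)).map (WittVector.frobenius : Ainf (p := p) F →+* Ainf (p := p) F) =
      (Q n).map (WittVector.frobenius : Ainf (p := p) F →+* Ainf (p := p) F) +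
        C ((p : Ainf (p := p) F) ^ n) * (R n).map (WittVector.frobenius : Ainf (p := p) F →+* Ainf (p := p) F) := fun n => by
    rw [hQR n, Polynomial.map_add, Polynomial.map_mul, map_C, map_pow, map_natCast]
  have e : frobBmaxPlus F p (algebraMap (bmaxZero F p) (BmaxPlus F p) omegaB) =
      algebraMap (bmaxZero F p) (BmaxPlus F p) (frobBmaxZero F p omegaB) := frobBmaxPlus_of omegaB
  rw [e]
  exact exists_eq_ainf_add_sub_mul_of_representatives hQ' hQR' d

/-! ### `φ(ω/p) ≡ 1 (mod (u/p)·A_max)` -/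

set_option maxHeartbeats 1600000 in
set_option synthInstance.maxHeartbeats 400000 in
omit [IsAdicComplete (Ideal.span {(p : integerC F)}) (integerC F)] in
/-- **`p·(φ(ξ/p)·ι(φ c) − 1) = ι(u)·ι(s)`** where `ω = ξ·c` and `φ(ω) − p = u·s`: apply `ι` to `φ(ω) = φ(ξ)·φ(c)` and use
`ι(φ ξ) = φ(ι ξ) = p·φ(ξ/p)`. This is `φ(ω/p) ≡ 1 (mod (u/p)·A_max)`, cleared of the denominator `p`. [cite: Colmez1998Annals, Lemme III.3.8] -/
theorem natCast_mul_frobBmaxPlus_omegaB_mul_sub_one {c s : Ainf (p := p) F} (hc : omega = xi * c)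
    (hs : (WittVector.frobenius : Ainf (p := p) F →+* Ainf (p := p) F) omega - (p : Ainf (p := p) F) = uAinf * s) :
    (p : BmaxPlus F p) * (frobBmaxPlus F p (algebraMap (bmaxZero F p) (BmaxPlus F p) omegaB) *
        ainfToBmaxPlus F p (WittVector.frobenius c) - 1) = ainfToBmaxPlus F p uAinf * ainfToBmaxPlus F p s := by
  have h1 : ainfToBmaxPlus F p ((WittVector.frobenius : Ainf (p := p) F →+* Ainf (p := p) F) omega) =
      (p : BmaxPlus F p) * (frobBmaxPlus F p (algebraMap (bmaxZero F p) (BmaxPlus F p) omegaB) *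
        ainfToBmaxPlus F p (WittVector.frobenius c)) := by
    rw [← frobBmaxPlus_ainfToBmaxPlus, hc, map_mul, ainfToBmaxPlus_xi, map_mul, map_mul, map_natCast,
      frobBmaxPlus_ainfToBmaxPlus]
    ring
  have h2 : ainfToBmaxPlus F p ((WittVector.frobenius : Ainf (p := p) F →+* Ainf (p := p) F) omega) =
      (p : BmaxPlus F p) + ainfToBmaxPlus F p uAinf * ainfToBmaxPlus F p s := by
    rw [show (WittVector.frobenius : Ainf (p := p) F →+* Ainf (p := p) F) omega = (p : Ainf (p := p) F) + uAinf * s by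
      rw [← hs]; ring, map_add, map_natCast, map_mul]
  rw [mul_sub, mul_one, ← h1, h2, add_sub_cancel_left]

set_option maxHeartbeats 1600000 in
set_option synthInstance.maxHeartbeats 400000 in
/-- ★★ **`p·φ(g) ∈ ι(𝔸_inf) + ι([ε] − 1)·A_max` for every `g ∈ A_max`** (Colmez: `φ(x) − φ(Σ_{n≥0}[a_n]) ∈ (([ε]−1)/p)·A_max`): take
`d = φ(c⁻¹)` in `exists_frobBmaxPlus_eq_ainf_add_sub_mul` (`ω = ξ·c` with `c ∈ 𝔸_infˣ` by `isUnit_of_omega_eq_xi_mul`) and use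
`p·(φ(ξ/p) − ι φ(c⁻¹)) = ι(φ c⁻¹)·ι(u)·ι(s)`. [cite: Colmez1998Annals, Lemme III.3.8] -/
theorem exists_natCast_mul_frobBmaxPlus_eq_ainf_add_uAinf_mul (g : BmaxPlus F p) :
    ∃ (a : Ainf (p := p) F) (G : BmaxPlus F p),
      (p : BmaxPlus F p) * frobBmaxPlus F p g = ainfToBmaxPlus F p a + ainfToBmaxPlus F p uAinf * G := by
  obtain ⟨c, hc, -⟩ := exists_omega_eq_xi_mul (F := F) (p := p)
  obtain ⟨s, hs⟩ := uAinf_dvd_frobenius_omega_sub_natCast (F := F) (p := p)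
  obtain ⟨w, hw⟩ := isUnit_of_omega_eq_xi_mul hc
  obtain ⟨a, G, h⟩ := exists_frobBmaxPlus_eq_ainf_add_sub_mul g (WittVector.frobenius (↑w⁻¹ : Ainf (p := p) F))
  have hcc' : c * (↑w⁻¹ : Ainf (p := p) F) = 1 := by rw [← hw, Units.mul_inv]
  have e1 : ainfToBmaxPlus F p (WittVector.frobenius c) *
      ainfToBmaxPlus F p (WittVector.frobenius (↑w⁻¹ : Ainf (p := p) F)) = 1 := by
    rw [← map_mul, ← map_mul, hcc', map_one, map_one]
  have e2 := natCast_mul_frobBmaxPlus_omegaB_mul_sub_one hc hs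
  have key : (p : BmaxPlus F p) * (frobBmaxPlus F p (algebraMap (bmaxZero F p) (BmaxPlus F p) omegaB) -
      ainfToBmaxPlus F p (WittVector.frobenius (↑w⁻¹ : Ainf (p := p) F))) =
      ainfToBmaxPlus F p (WittVector.frobenius (↑w⁻¹ : Ainf (p := p) F)) * (ainfToBmaxPlus F p uAinf * ainfToBmaxPlus F p s) := by
    rw [← e2]
    linear_combination (-((p : BmaxPlus F p) * frobBmaxPlus F p (algebraMap (bmaxZero F p) (BmaxPlus F p) omegaB))) * e1
  refine ⟨(p : Ainf (p := p) F) * a, ainfToBmaxPlus F p (WittVector.frobenius (↑w⁻¹ : Ainf (p := p) F) * s) * G, ?_⟩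
  calc (p : BmaxPlus F p) * frobBmaxPlus F p g
      = (p : BmaxPlus F p) * ainfToBmaxPlus F p a +
          (p : BmaxPlus F p) * (frobBmaxPlus F p (algebraMap (bmaxZero F p) (BmaxPlus F p) omegaB) -
            ainfToBmaxPlus F p (WittVector.frobenius (↑w⁻¹ : Ainf (p := p) F))) * G := by rw [h]; ring
    _ = ainfToBmaxPlus F p ((p : Ainf (p := p) F) * a) +
          ainfToBmaxPlus F p uAinf * (ainfToBmaxPlus F p (WittVector.frobenius (↑w⁻¹ : Ainf (p := p) F) * s) * G) := by
        rw [key, map_mul, map_natCast, map_mul]; ring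

/-! ### Colmez's Lemme III.3.4 -/

set_option maxHeartbeats 1600000 in
set_option synthInstance.maxHeartbeats 400000 in
/-- ★★★ **Colmez's `t`-divisibility criterion, Frobenius form [Colmez1998Annals, Lemme III.3.4]**: if `x ∈ A_max = B_max⁺(F)` satisfies
`θ(φᵏ(x)) = 0` for every `k ≥ 0`, then `p·φ(x) ∈ t·A_max`. (Write `p·φ(x) = ι(a) + ι([ε]−1)·G`; applying `θ ∘ φᵏ` kills the left
side and the second term since `θ(φᵏ([ε]−1)) = θ([ε^{pᵏ}]) − 1 = 0`, so `θ(φᵏ a) = 0` for all `k`, whence `a ∈ ([ε]−1)·𝔸_inf` by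
Fontaine's `𝔸_inf`-lemma [Colmez1998Annals, Lemme III.3.7]; finally `[ε] − 1 ∈ t·A_maxˣ` [Colmez1998Annals, Lemme III.3.9].)
[cite: Colmez1998Annals, Lemme III.3.4] -/
theorem exists_natCast_mul_frobBmaxPlus_eq_tBmax_mul {x : BmaxPlus F p}
    (hx : ∀ k, thetaBmaxPlus F p ((frobBmaxPlus F p)^[k] x) = 0) :
    ∃ y : BmaxPlus F p, (p : BmaxPlus F p) * frobBmaxPlus F p x = tBmax * y := by
  obtain ⟨a, G, h⟩ := exists_natCast_mul_frobBmaxPlus_eq_ainf_add_uAinf_mul x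
  have ha : ∀ k, fontaineTheta (integerC F) p
      ((WittVector.frobenius : Ainf (p := p) F →+* Ainf (p := p) F)^[k] a) = 0 := by
    intro k
    have e1 : thetaBmaxPlus F p ((frobBmaxPlus F p)^[k]
        (ainfToBmaxPlus F p a + ainfToBmaxPlus F p uAinf * G)) = 0 := by
      rw [← h, iterate_map_mul, frobBmaxPlus_iterate_natCast, ← Function.iterate_succ_apply, map_mul, map_natCast, hx,
        mul_zero]
    rw [iterate_map_add, iterate_map_mul, map_add, map_mul] at e1
    simpa only [thetaBmaxPlus_frobBmaxPlus_iterate_ainfToBmaxPlus, fontaineTheta_frobenius_iterate_uAinf, zero_mul,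
      add_zero] using e1
  obtain ⟨b, hb⟩ := uAinf_dvd_of_forall_fontaineTheta_frobenius_iterate_eq_zero ha
  obtain ⟨v, hv, hvt⟩ := exists_isUnit_tBmax_eq_uAinf_mul' (F := F) (p := p)
  obtain ⟨w, hw⟩ := hv
  have e2 : ainfToBmaxPlus F p uAinf = tBmax * (↑w⁻¹ : BmaxPlus F p) := by
    rw [hvt, ← hw, mul_assoc, Units.mul_inv, mul_one]
  refine ⟨(↑w⁻¹ : BmaxPlus F p) * (ainfToBmaxPlus F p b + G), ?_⟩
  rw [h, hb, map_mul, e2]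
  ring

set_option maxHeartbeats 1600000 in
set_option synthInstance.maxHeartbeats 400000 in
/-- **Saturated form**: under the same hypothesis, `p^{k}·φᵏ(x) ∈ t·A_max` for every `k ≥ 1` (`φ(t) = p·t` and `φ` preserves the
hypothesis). [cite: Colmez1998Annals, Lemme III.3.4] -/
theorem exists_pow_mul_frobBmaxPlus_iterate_eq_tBmax_mul {x : BmaxPlus F p}
    (hx : ∀ k, thetaBmaxPlus F p ((frobBmaxPlus F p)^[k] x) = 0) {k : ℕ} (hk : 1 ≤ k) :
    ∃ y : BmaxPlus F p, (p : BmaxPlus F p) ^ k * (frobBmaxPlus F p)^[k] x = tBmax * y := by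
  induction k, hk using Nat.le_induction with
  | base =>
    obtain ⟨y, hy⟩ := exists_natCast_mul_frobBmaxPlus_eq_tBmax_mul hx
    exact ⟨y, by rw [pow_one, Function.iterate_one, hy]⟩
  | succ k hk ih =>
    obtain ⟨y, hy⟩ := ih
    refine ⟨(p : BmaxPlus F p) ^ 2 * frobBmaxPlus F p y, ?_⟩
    have e := congrArg (frobBmaxPlus F p) hy
    rw [map_mul, map_pow, map_natCast, map_mul, frobBmaxPlus_tBmax, map_natCast,
      ← Function.iterate_succ_apply' (frobBmaxPlus F p) k x] at e
    calc (p : BmaxPlus F p) ^ (k + 1) * (frobBmaxPlus F p)^[k + 1] x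
        = (p : BmaxPlus F p) * ((p : BmaxPlus F p) ^ k * (frobBmaxPlus F p)^[k + 1] x) := by ring
      _ = (p : BmaxPlus F p) * ((p : BmaxPlus F p) * tBmax * frobBmaxPlus F p y) := by rw [e]
      _ = tBmax * ((p : BmaxPlus F p) ^ 2 * frobBmaxPlus F p y) := by ring

end Literature.NumberTheory.PAdicHodge

end
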